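import Summits.BirchSwinnertonDyer.BirchSwinnertonDyer.Theorems.KatoDescentPotSupersingularReducibleKatoMemberNodes
import Literature.NumberTheory.EllipticCurves.Kato2004.MemberHullZetaInputs
import Literature.NumberTheory.EllipticCurves.Kato2004.IwasawaCohomologyExistsProofs
import Literature.NumberTheory.EllipticCurves.Kato2004.DivisibilityInputs
import Literature.NumberTheory.EllipticCurves.IwasawaEulerCharProofs
import Literature.NumberTheory.EllipticCurves.IwasawaAlgebraDivisibilityProofs
import HarnessLib

/-!
# Crux M `ReducibleKatoMember` (item stmt-BirchSwinnertonDyer-19196, K9 / K8-t′) needs NO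
# Gross–Zagier–Kolyvagin: Kato Thm. 14.5 (1) at the member is a CONSEQUENCE of the zeta-only package
# `Kato2004.MemberHullZetaInputs` (Thm. 12.5 (3) at the height-one prime `(γ − 1)` + Thm. 14.5 (2)),
# so `exists_memberHullZetaInputs → exists_memberHullInputs` holds UNCONDITIONALLY and the node
# `O6.KatoMemberShaBoundOfReducible` follows from `exists_isNewformOf ∧ exists_memberHullZetaInputs` alone

Cell `bsd-potss`, seat `bsd-potss-rkm` generation 13; ROUTE-FREE; `--supports stmt-BirchSwinnertonDyer-19196`.

## What was held, and what this file removes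

The live split (gen 2 / gen 3) of crux M reads `PublishedInputNewformKatoZ → PublishedInputMemberHullZetaInputs
→ PublishedInputRankEqAnalyticRankZ → ReducibleKatoMember` (K9; KT twin with suffix `T`), the glue being
closed over `ReducibleOfZetaInputs.katoMemberShaBoundOfReducible_of_memberHullZetaInputs (hmod) (hZ) (hGZK)`
(rkm g10).  In that chain Gross–Zagier–Kolyvagin (`rank_eq_analyticRank_of_analyticRank_le_one`, child
20298 / KT twin) is used at exactly ONE place: the Literature conversion
`Kato2004.exists_memberHullInputs_of_zetaInputs (hGZK) (hR0)` restores the dropped clause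
`finite_coinvariants_H2` of `MemberHullInputs` (Kato Thm. 14.5 (1) with (14.14.2): `H²(ℤ[1/p], T) = 𝐇²/X𝐇²`
is finite) from the base-level bound (R0) `rank_{ℤ_p} H¹(ℤ[1/p], T_pW′) ≤ 1`, which needs `W′(ℚ)` and
`Ш(W′)[p^∞]` finite — i.e. rank `0` from `L(W,1) ≠ 0`, by GZK (route docstring of
`PublishedInputRankEqAnalyticRankZ`: «needed here because the zeta-only package yields Kato's
MemberHullInputs only for W(ℚ) finite»).

THIS FILE proves `finite_coinvariants_H2` for EVERY zeta package from the package's OWN fields, on every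
cyclotomic pin — Kato's own road to Thm. 14.5 (1) (Astérisque 295, p. 243, 14.13–14.15: the `Λ`-adic
divisibility Thm. 12.5 (3) at the height-one prime `𝔭 = (γ − 1) ∌ p` plus the non-vanishing of the zeta
value, descended by (14.14.1)–(14.14.2)), which does not pass through Gross–Zagier or Kolyvagin:

1. `index_ne_zero` (Thm. 14.5 (2): `[A : Λ·ι(ȳ)]` finite, `A = H¹(ℤ[1/p],T)`) and the injectivity of
   `ι : 𝐇¹_Γ/X𝐇¹_Γ ↪ A` ((14.14.1), `MemberHullZetaInputs.ι_injective`) give `(𝐇¹_Γ/X𝐇¹_Γ)/Λȳ` finite, hence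
   — coinvariants are right exact (`IwasawaAlgebra.exact_coinvariantsMap`) — the coinvariants of
   `Q := 𝐇¹_Γ/Λ𝐲` are finite (§2 `finite_coinvariants_quotient_span_y`);
2. `Q` is a finitely generated TORSION `Λ`-module (`j 𝐲 = λ z`, `F/Λz` torsion, `j` injective), so by the
   `Γ`-Euler-characteristic calculus of `IwasawaEulerCharProofs` (`ℓ_{(T)}(Q) = ℓ(TQ) + ℓ(Q/TQ)`,
   `ℓ(TQ) = 0 ↔ ℓ(ker φ_Q) = 0`, `ℓ(ker φ_Q) = ℓ(coker φ_Q)`) its local length at `𝔭_T = (T)` vanishes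
   (§1 `lengthAt_primeT_eq_zero_of_finite_coinvariants` — generic);
3. along `0 → 𝐇¹_Γ/Λ𝐲 → F/Λ·j𝐲 → F/j𝐇¹_Γ → 0` (hull cokernel FINITE, 13.14) and `F/Λ·j𝐲 ↠ F/Λz`
   (`j𝐲 = λ z ∈ Λz`): `ℓ_{(T)}(F/Λz) = 0` (§2 `lengthAt_primeT_quotient_span_z_eq_zero`);
4. the package's Thm. 12.5 (3) clause `divisibility_offP` at `𝔮 = (T)` (height one, `≠ (p)`) gives
   `ℓ_{(T)}(𝐇²) = 0`, and `IwasawaAlgebra.card_coinvariants_of_lengthAt_eq_zero` (Greenberg LNM 1716 §4 /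
   Thm. 4.1, PROVED in the tree) gives `𝐇²[X]` and `𝐇²/X𝐇²` finite (§2 `finite_invariants_H2`,
   `finite_coinvariants_H2`).

Consequences (§3–§4): `nonempty_memberHullInputs` (every zeta package IS a full `MemberHullInputs` package on
a cyclotomic pin); the FACT-LEVEL `exists_memberHullInputs_of_zetaInputs'` :
`exists_memberHullZetaInputs → exists_memberHullInputs` with NO hypothesis (so the two held constants are
EQUIVALENT, `exists_memberHullInputs_iff_zetaInputs`); and the node
`katoMemberShaBoundOfReducible_of_newform_of_zetaInputs (hmod) (hZ) : O6.KatoMemberShaBoundOfReducible` —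
crux M from {modularity, the zeta package} ONLY.  The child `PublishedInputRankEqAnalyticRankZ` (20298; KT
twin `…ZT`) of M's split is IDLE: the sibling typed closers
`KatoDescent{,Tame}PotSupersingularReducibleKatoMemberOfZetaInputsNoGZK.lean` give the planner the 2-ary
glue term (the live 3-ary glue is closed by `fun hN hZ _ => … hN hZ`).  (GZK of course stays in both routes' cones for the rank-`0` rows' own `closes`; what changes is
M's split and the sentence «the zeta-only package yields MemberHullInputs only for W(ℚ) finite».)

HONEST FRAMING.  Nothing is booked; no item closes; BSD is not advanced; `exists_memberHullZetaInputs` remains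
the cite-level transcription of Kato Thm. 12.5 / 12.6 / 13.10 (1) / 13.14 / 14.5 (2) / 14.16 (2) + Wuthrich
L.14 at Kato's member (Kato's Euler system; no `_holds` expected).  This file only shows that the
transcription already CONTAINS Kato's Thm. 14.5 (1) («`H²(ℤ[1/p],T)` is finite and
`rank_{O_λ} H¹(ℤ[1/p],T) = 1`») — as in print, where 14.5 (1) is deduced from 12.5 (3) and 14.5 (2), not
from Gross–Zagier.

References: K. Kato, Astérisque 295 (2004), Thm. 12.5 (3) (p. 222), 13.14 (p. 234), Thm. 14.5 (1)(2) (p. 236),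
14.13–14.15 and (14.14.1)–(14.14.2) (p. 243) [Kato2004Asterisque]; R. Greenberg, LNM 1716 (1999) §4 Thm. 4.1 /
Lemma 4.2 [GreenbergLNM1716]; L. Washington, *Cyclotomic Fields* §13.2 [Washington1997]; tree
`IwasawaEulerCharProofs`, `Kato2004/MemberHullZetaInputs` (p519008), `Theorems/…ReducibleKatoMemberNodes`.
-/

set_option autoImplicit false
-- sibling precedent (`…ReducibleKatoMemberOfInputs.lean`): the directory name repeats the summit name
set_option linter.dupNamespace false

noncomputable section

open scoped NumberField TensorProduct
open Field IsDedekindDomain CongruenceSubgroup Function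
open Literature.NumberTheory.GaloisRepresentations
open Literature.NumberTheory.EllipticCurves Literature.NumberTheory.EllipticCurves.ModularForms
open Literature.NumberTheory.EllipticCurves.Kato2004
open Literature.NumberTheory.EllipticCurves.Kato2004.EulerSystemValues Rat.HeightOneSpectrum
open Literature.NumberTheory.EllipticCurves.IwasawaAlgebra

namespace Summit.BirchSwinnertonDyer.BirchSwinnertonDyer.Theorems.ZetaInputsDescent

universe u

/-! ## §1 Generic `Λ`-algebra at the prime `𝔭_T = (T)` -/

section Algebra

variable {p : ℕ} [Fact p.Prime]

/-- `p ∉ (T)`: the constant power series `p` has non-zero constant term. [folklore] -/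
theorem C_natCast_notMem_primeT :
    PowerSeries.C (p : ℤ_[p]) ∉ (primeT p).asIdeal := by
  rw [primeT_asIdeal, mem_span_X_iff]
  simp [(Fact.out : p.Prime).ne_zero]

/-- `(T) ≠ (p)` as ideals of `Λ = ℤ_p⟦T⟧`. [folklore] -/
theorem primeT_asIdeal_ne_augIdealP : (primeT p).asIdeal ≠ augIdealP p := by
  intro h
  apply C_natCast_notMem_primeT (p := p)
  rw [h]
  exact Ideal.subset_span rfl

/-- A FINITE `Λ`-module has local length `0` at `(T)` (it is killed by its order `p^a·u`, and `p ∉ (T)`).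
[folklore] -/
theorem lengthAt_primeT_eq_zero_of_finite (C : Type*) [AddCommGroup C] [Module (IwasawaAlgebra p) C]
    [Finite C] : Module.lengthAt (IwasawaAlgebra p) C (primeT p) = 0 :=
  Kato2004.lengthAt_eq_zero_of_finite_of_C_not_mem C (primeT p) C_natCast_notMem_primeT

/-- **A finitely generated torsion `Λ`-module with FINITE `Γ`-coinvariants has local length `0` at
`𝔭_T = (T)`** (no `(T)`-primary elementary divisor; Washington §13.2 / Greenberg LNM 1716 §4).  Proof by the
tree's `Γ`-Euler-characteristic calculus: `ℓ(Q) = ℓ(TQ) + ℓ(Q/TQ)`; `ℓ(Q/TQ) = 0` as `Q/TQ` is finite and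
killed by `T`; `ℓ(TQ) = 0 ↔ ℓ(ker φ_Q) = 0`, and `ℓ(ker φ_Q) = ℓ(coker φ_Q) = 0`, `coker φ_Q` being a quotient
of the finite `Q/TQ`. [cite: GreenbergLNM1716, §4 (Thm. 4.1 and Lemma 4.2)] [cite: Washington1997, §13.2] -/
theorem lengthAt_primeT_eq_zero_of_finite_coinvariants (Q : Type u) [AddCommGroup Q]
    [Module (IwasawaAlgebra p) Q] [Module.Finite (IwasawaAlgebra p) Q]
    (hQ : Module.IsTorsion (IwasawaAlgebra p) Q) (hfin : Finite (coinvariants p Q)) :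
    Module.lengthAt (IwasawaAlgebra p) Q (primeT p) = 0 := by
  -- `ℓ(Q/TQ) = 0`
  have h1 : Module.lengthAt (IwasawaAlgebra p) (coinvariants p Q) (primeT p) = 0 :=
    (finite_iff_lengthAt_eq_zero_of_X_smul_eq_zero p (coinvariants p Q)
      (X_smul_coinvariants p Q)).mp hfin
  -- `coker φ_Q` is finite and killed by `T`, so `ℓ(coker φ_Q) = 0`
  have h2 : Module.lengthAt (IwasawaAlgebra p)
      (coinvariants p Q ⧸ LinearMap.range (bockstein p Q)) (primeT p) = 0 := by
    haveI : Finite (coinvariants p Q ⧸ LinearMap.range (bockstein p Q)) :=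
      Finite.of_surjective _ (Submodule.mkQ_surjective _)
    refine (finite_iff_lengthAt_eq_zero_of_X_smul_eq_zero p _ fun x ↦ ?_).mp this
    induction x using Submodule.Quotient.induction_on with
    | H q => rw [← Submodule.Quotient.mk_smul, X_smul_coinvariants p Q q, Submodule.Quotient.mk_zero]
  -- hence `ℓ(ker φ_Q) = 0` and `ℓ(TQ) = 0`
  have h3 : Module.lengthAt (IwasawaAlgebra p) (LinearMap.ker (bockstein p Q)) (primeT p) = 0 := by
    rw [lengthAt_ker_bockstein_eq_lengthAt_coker p Q hQ]; exact h2
  have h4 : Module.lengthAt (IwasawaAlgebra p) (TSubmodule p Q) (primeT p) = 0 :=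
    (lengthAt_TSubmodule_eq_zero_iff p Q hQ).mpr h3
  rw [lengthAt_eq_TSubmodule_add_coinvariants p Q, h4, h1, zero_add]

end Algebra

/-! ## §2 On a zeta package: `ℓ_{(T)}(𝐇¹_Γ/Λ𝐲) = ℓ_{(T)}(F/Λz) = ℓ_{(T)}(𝐇²) = 0`, hence Thm. 14.5 (1) -/

section Package

variable {W : WeierstrassCurve ℚ} [W.IsElliptic] {p : ℕ} [Fact p.Prime]
  [ContinuousSMul ℤ_[p] (W.tateModule p)] {κ : ZpExtension ℚ p} {γ : absoluteGaloisGroup ℚ}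
  {I : IwasawaH1Data W p κ γ} {y : I.H}

/-- **`𝐇¹_Γ/Λ𝐲` is a torsion `Λ`-module** on every zeta package: for `h ∈ 𝐇¹_Γ`, `F/Λz` torsion gives
`s ≠ 0` and `t` with `s·jh = t·z`, whence `j(λs·h) = t·(λz) = t·j𝐲` and `λs·h = t·𝐲` (`j` injective),
`λs ≠ 0`. [cite: Kato2004Asterisque, Thm. 12.5 (1)(2) (pp. 221–222) and Lemma 13.10 (1) (p. 230)] -/
theorem isTorsion_quotient_span_y (Z : MemberHullZetaInputs W p κ γ I y) :
    Module.IsTorsion (IwasawaAlgebra p) (I.H ⧸ (IwasawaAlgebra p) ∙ y) := by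
  intro q
  induction q using Submodule.Quotient.induction_on with
  | H h =>
    have hlam : Z.lam ≠ 0 := fun h0 ↦ Z.lam_constantCoeff_ne_zero (by rw [h0, map_zero])
    obtain ⟨⟨s, hs⟩, hsz⟩ := @Z.isTorsion_quotient (Submodule.Quotient.mk (Z.j h))
    rw [Submonoid.mk_smul, ← Submodule.Quotient.mk_smul, Submodule.Quotient.mk_eq_zero,
      Submodule.mem_span_singleton] at hsz
    obtain ⟨t, ht⟩ := hsz
    have hs0 : s ≠ 0 := nonZeroDivisors.ne_zero hs
    refine ⟨⟨Z.lam * s, mem_nonZeroDivisors_of_ne_zero (mul_ne_zero hlam hs0)⟩, ?_⟩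
    rw [Submonoid.mk_smul, ← Submodule.Quotient.mk_smul, Submodule.Quotient.mk_eq_zero,
      Submodule.mem_span_singleton]
    refine ⟨t, Z.j_injective ?_⟩
    rw [map_smul, map_smul, Z.j_y, mul_smul, ← ht, smul_comm]

/-- **The coinvariants of `𝐇¹_Γ/Λ𝐲` are FINITE** on every zeta package over a cyclotomic pin: by Thm. 14.5 (2)
(`index_ne_zero`: `A/Λ·ι(ȳ)` finite) and the injectivity of `ι` ((14.14.1)), `(𝐇¹_Γ/X)/Λȳ ↪ A/Λ·ι(ȳ)` is
finite, and `(𝐇¹_Γ/Λ𝐲)/X ≅ (𝐇¹_Γ/X)/Λȳ` by right-exactness of coinvariants.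
[cite: Kato2004Asterisque, Thm. 14.5 (2) (p. 236) and §14.14 (14.14.1) (p. 243)] -/
theorem finite_coinvariants_quotient_span_y (Z : MemberHullZetaInputs W p κ γ I y)
    (hκ : κ.IsCyclotomic) (hγ : κ.IsTopGenerator γ) :
    Finite (coinvariants p (I.H ⧸ (IwasawaAlgebra p) ∙ y)) := by
  classical
  set Λy : Submodule (IwasawaAlgebra p) I.H := (IwasawaAlgebra p) ∙ y with hΛy
  -- right-exactness of coinvariants along `0 → Λy → H → H/Λy → 0`
  have hex := exact_coinvariantsMap Λy.subtype Λy.mkQ (Submodule.mkQ_surjective _)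
    (LinearMap.exact_subtype_mkQ Λy)
  let e := hex.linearEquivOfSurjective
    (coinvariantsMap_surjective Λy.mkQ (Submodule.mkQ_surjective _))
  -- the finite target `A/Λ·ι(ȳ)`
  haveI hA : Finite (Z.A ⧸ (IwasawaAlgebra p) ∙ Z.ι (Submodule.Quotient.mk y)) :=
    Nat.finite_of_card_ne_zero Z.index_ne_zero
  -- the comparison map `(H/X)/range → A/Λ·ι(ȳ)` induced by `ι`
  have hle : LinearMap.range (coinvariantsMap Λy.subtype) ≤
      Submodule.comap Z.ι ((IwasawaAlgebra p) ∙ Z.ι (Submodule.Quotient.mk y)) := by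
    rintro _ ⟨v, rfl⟩
    induction v using Submodule.Quotient.induction_on with
    | H u =>
      obtain ⟨u, hu⟩ := u
      obtain ⟨a, rfl⟩ := Submodule.mem_span_singleton.mp hu
      rw [Submodule.mem_comap, coinvariantsMap_mk, Submodule.coe_subtype, Submodule.Quotient.mk_smul,
        map_smul]
      exact Submodule.smul_mem _ a (Submodule.mem_span_singleton_self _)
  let ψ := Submodule.mapQ _ _ Z.ι hle
  have hψ : Function.Injective ψ := by
    rw [injective_iff_map_eq_zero]
    intro q hq
    induction q using Submodule.Quotient.induction_on with
    | H q =>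
      rw [Submodule.mapQ_apply, Submodule.Quotient.mk_eq_zero, Submodule.mem_span_singleton] at hq
      obtain ⟨a, ha⟩ := hq
      rw [← map_smul] at ha
      have hqa : q = a • Submodule.Quotient.mk y := (Z.ι_injective hκ hγ ha).symm
      rw [Submodule.Quotient.mk_eq_zero, hqa]
      refine ⟨Submodule.Quotient.mk (a • ⟨y, Submodule.mem_span_singleton_self y⟩), ?_⟩
      rw [coinvariantsMap_mk, map_smul, Submodule.coe_subtype, Submodule.Quotient.mk_smul]
  haveI : Finite (coinvariants p I.H ⧸ LinearMap.range (coinvariantsMap Λy.subtype)) :=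
    Finite.of_injective ψ hψ
  exact Finite.of_equiv _ e.toEquiv

/-- **`ℓ_{(T)}(𝐇¹_Γ/Λ𝐲) = 0`** on every zeta package over a cyclotomic pin (§1 applied to the finitely generated
torsion module `𝐇¹_Γ/Λ𝐲` with finite coinvariants). [cite: Kato2004Asterisque, Thm. 14.5 (2) (p. 236), (12.2.1) (p. 220)] -/
theorem lengthAt_primeT_quotient_span_y_eq_zero (Z : MemberHullZetaInputs W p κ γ I y)
    (hκ : κ.IsCyclotomic) (hγ : κ.IsTopGenerator γ) :
    Module.lengthAt (IwasawaAlgebra p) (I.H ⧸ (IwasawaAlgebra p) ∙ y) (primeT p) = 0 := by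
  haveI := IwasawaH1Data.module_finite_of_isCyclotomic hκ hγ I
  exact lengthAt_primeT_eq_zero_of_finite_coinvariants _ (isTorsion_quotient_span_y Z)
    (finite_coinvariants_quotient_span_y Z hκ hγ)

/-- **`ℓ_{(T)}(F/Λz) = 0`** on every zeta package over a cyclotomic pin: along the exact sequence
`0 → 𝐇¹_Γ/Λ𝐲 → F/Λ·j𝐲 → F/j𝐇¹_Γ → 0` (hull cokernel finite, 13.14) `ℓ_{(T)}(F/Λ·j𝐲) = 0 + 0`, and
`F/Λ·j𝐲 ↠ F/Λz` since `j𝐲 = λz`. [cite: Kato2004Asterisque, 13.14 (p. 234) and Lemma 13.10 (1) (p. 230)]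
[cite: Wuthrich2014, Lemma 12 (p. 395)] -/
theorem lengthAt_primeT_quotient_span_z_eq_zero (Z : MemberHullZetaInputs W p κ γ I y)
    (hκ : κ.IsCyclotomic) (hγ : κ.IsTopGenerator γ) :
    Module.lengthAt (IwasawaAlgebra p) (Z.F ⧸ (IwasawaAlgebra p) ∙ Z.z) (primeT p) = 0 := by
  classical
  -- the three quotients
  set Λy : Submodule (IwasawaAlgebra p) I.H := (IwasawaAlgebra p) ∙ y
  set Λjy : Submodule (IwasawaAlgebra p) Z.F := (IwasawaAlgebra p) ∙ Z.j y
  set Λz : Submodule (IwasawaAlgebra p) Z.F := (IwasawaAlgebra p) ∙ Z.z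
  -- `f₁ : H/Λy → F/Λ·jy` induced by `j`, injective
  have hle₁ : Λy ≤ Submodule.comap Z.j Λjy := by
    rw [Submodule.span_singleton_le_iff_mem, Submodule.mem_comap]
    exact Submodule.mem_span_singleton_self _
  let f₁ := Submodule.mapQ Λy Λjy Z.j hle₁
  have hf₁ : Function.Injective f₁ := by
    rw [injective_iff_map_eq_zero]
    intro q hq
    induction q using Submodule.Quotient.induction_on with
    | H h =>
      rw [Submodule.mapQ_apply, Submodule.Quotient.mk_eq_zero, Submodule.mem_span_singleton] at hq
      obtain ⟨a, ha⟩ := hq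
      rw [← map_smul] at ha
      rw [Submodule.Quotient.mk_eq_zero, Submodule.mem_span_singleton]
      exact ⟨a, Z.j_injective ha⟩
  -- `g₁ : F/Λ·jy → F/range j`, surjective
  have hle₂ : Λjy ≤ Submodule.comap (LinearMap.id : Z.F →ₗ[IwasawaAlgebra p] Z.F) (LinearMap.range Z.j) := by
    rw [Submodule.span_singleton_le_iff_mem, Submodule.mem_comap]
    exact ⟨y, rfl⟩
  let g₁ := Submodule.mapQ Λjy (LinearMap.range Z.j) LinearMap.id hle₂
  have hg₁ : Function.Surjective g₁ := by
    intro q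
    induction q using Submodule.Quotient.induction_on with
    | H x => exact ⟨Submodule.Quotient.mk x, rfl⟩
  -- exactness in the middle
  have hex : Function.Exact f₁ g₁ := by
    intro q
    induction q using Submodule.Quotient.induction_on with
    | H x =>
      constructor
      · intro hx
        rw [Submodule.mapQ_apply, LinearMap.id_apply, Submodule.Quotient.mk_eq_zero] at hx
        obtain ⟨h, rfl⟩ := hx
        exact ⟨Submodule.Quotient.mk h, rfl⟩
      · rintro ⟨q, hq⟩
        induction q using Submodule.Quotient.induction_on with
        | H h =>
          rw [Submodule.mapQ_apply] at hq
          rw [Submodule.mapQ_apply, LinearMap.id_apply, Submodule.Quotient.mk_eq_zero]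
          have hdiff : x - Z.j h ∈ Λjy := by
            rw [← Submodule.Quotient.eq]; exact hq.symm
          obtain ⟨a, ha⟩ := Submodule.mem_span_singleton.mp hdiff
          refine ⟨a • y + h, ?_⟩
          rw [map_add, map_smul, ha, sub_add_cancel]
  -- lengths
  haveI : Finite (Z.F ⧸ LinearMap.range Z.j) := Z.finite_coker
  have hjy : Module.lengthAt (IwasawaAlgebra p) (Z.F ⧸ Λjy) (primeT p) = 0 := by
    rw [Module.lengthAt_eq_add_of_exact f₁ g₁ hf₁ hg₁ hex (primeT p),
      lengthAt_primeT_quotient_span_y_eq_zero Z hκ hγ, lengthAt_primeT_eq_zero_of_finite, add_zero]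
  -- `F/Λ·jy ↠ F/Λz`
  have hle₃ : Λjy ≤ Submodule.comap (LinearMap.id : Z.F →ₗ[IwasawaAlgebra p] Z.F) Λz := by
    rw [Submodule.span_singleton_le_iff_mem, Submodule.mem_comap, LinearMap.id_apply, Z.j_y]
    exact Submodule.smul_mem _ _ (Submodule.mem_span_singleton_self _)
  let g₂ := Submodule.mapQ Λjy Λz LinearMap.id hle₃
  have hg₂ : Function.Surjective g₂ := by
    intro q
    induction q using Submodule.Quotient.induction_on with
    | H x => exact ⟨Submodule.Quotient.mk x, rfl⟩
  exact nonpos_iff_eq_zero.mp (hjy ▸ Module.lengthAt_le_of_surjective g₂ hg₂ (primeT p))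

/-- **`ℓ_{(T)}(𝐇²) = 0`** on every zeta package over a cyclotomic pin: the package's Thm. 12.5 (3) clause
`divisibility_offP` at the height-one prime `(T) ≠ (p)` bounds `ℓ_{(T)}(𝐇²)` by `ℓ_{(T)}(F/Λz) = 0`.
[cite: Kato2004Asterisque, Thm. 12.5 (3) (p. 222) and Rem. 12.7 (p. 222)] -/
theorem lengthAt_primeT_H2_eq_zero (Z : MemberHullZetaInputs W p κ γ I y)
    (hκ : κ.IsCyclotomic) (hγ : κ.IsTopGenerator γ) :
    Module.lengthAt (IwasawaAlgebra p) Z.H2 (primeT p) = 0 :=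
  nonpos_iff_eq_zero.mp (lengthAt_primeT_quotient_span_z_eq_zero Z hκ hγ ▸
    Z.divisibility_offP (primeT p) (height_primeT p) primeT_asIdeal_ne_augIdealP)

/-- **Kato Thm. 14.5 (1), first half, on the pin — GZK-free**: `𝐇²[X]` is finite on every zeta package over
a cyclotomic pin. [cite: Kato2004Asterisque, Thm. 14.5 (1) (p. 236) and 14.13 (p. 243)]
[cite: GreenbergLNM1716, §4 (Thm. 4.1 and Lemma 4.2)] -/
theorem finite_invariants_H2 (Z : MemberHullZetaInputs W p κ γ I y)
    (hκ : κ.IsCyclotomic) (hγ : κ.IsTopGenerator γ) : Finite (invariants p Z.H2) := by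
  haveI := Z.finite_H2
  exact (card_coinvariants_of_lengthAt_eq_zero Z.H2 Z.isTorsion_H2
    (lengthAt_primeT_H2_eq_zero Z hκ hγ)).1

/-- **Kato Thm. 14.5 (1) with (14.14.2) on the pin — GZK-free: `H²(ℤ[1/p],T) = 𝐇²/X𝐇²` is FINITE** on every
zeta package over a cyclotomic pin.  This is the clause `finite_coinvariants_H2` of `MemberHullInputs`,
previously restored only from (R0) = `W(ℚ)`, `Ш[p^∞]` finite (Gross–Zagier–Kolyvagin).
[cite: Kato2004Asterisque, Thm. 14.5 (1) (p. 236), 14.13–14.15 and (14.14.2) (p. 243)]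
[cite: GreenbergLNM1716, §4 (Thm. 4.1 and Lemma 4.2)] -/
theorem finite_coinvariants_H2 (Z : MemberHullZetaInputs W p κ γ I y)
    (hκ : κ.IsCyclotomic) (hγ : κ.IsTopGenerator γ) : Finite (coinvariants p Z.H2) := by
  haveI := Z.finite_H2
  exact (card_coinvariants_of_lengthAt_eq_zero Z.H2 Z.isTorsion_H2
    (lengthAt_primeT_H2_eq_zero Z hκ hγ)).2.1

/-- **Every zeta package over a cyclotomic pin IS a full `MemberHullInputs` package** (the four dropped
clauses are theorems: `finite_H`, `torsionFree_H`, `ι_injective` by the typer's conversion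
`MemberHullZetaInputs.toMemberHullInputs`, `finite_coinvariants_H2` by this file).
[cite: Kato2004Asterisque, (12.2.1) (p. 220), Thm. 12.4 (2) (p. 221), Thm. 14.5 (1) (p. 236), §14.14 (14.14.1)–(14.14.2) (p. 243)] -/
theorem nonempty_memberHullInputs (Z : MemberHullZetaInputs W p κ γ I y)
    (hκ : κ.IsCyclotomic) (hγ : κ.IsTopGenerator γ) : Nonempty (MemberHullInputs W p κ γ I y) :=
  ⟨Z.toMemberHullInputs hκ hγ (finite_coinvariants_H2 Z hκ hγ)⟩

end Package

/-! ## §3 Fact level: the two held constants are EQUIVALENT (no Gross–Zagier–Kolyvagin, no (R0)) -/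

/-- **`exists_memberHullZetaInputs → exists_memberHullInputs` UNCONDITIONALLY** (the typer's
`exists_memberHullInputs_of_zetaInputs` with BOTH displayed hypotheses `hGZK`, `hR0` discharged — not by
proving them, but because the conversion never needed them: §2 `nonempty_memberHullInputs`).
[cite: Kato2004Asterisque, Thm. 12.5 (3) (p. 222), Thm. 14.5 (1)(2) (p. 236), §14.14 (14.14.1)–(14.14.2) (p. 243)] -/
theorem exists_memberHullInputs_of_zetaInputs' (h : Kato2004.exists_memberHullZetaInputs) :
    Kato2004.exists_memberHullInputs := by
  intro W _ _ p _ hp hgood hmult hj hirr hL hsha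
  obtain ⟨W', hW'e, hW'm, hiso, hrest⟩ := h W p hp hgood hmult hj hirr hL hsha
  haveI := hW'e
  refine ⟨W', hW'e, hW'm, hiso, ?_⟩
  intro _ _ _ N _ f hf ι
  obtain ⟨κ', Λ', c, d, a, A, z, x, hκ', hA, hc, hd, hZB, hall⟩ := hrest f hf ι
  refine ⟨κ', Λ', c, d, a, A, z, x, hκ', hA, hc, hd, hZB, ?_⟩
  intro κ γ hκ hγ I y hy
  obtain ⟨Z⟩ := hall κ γ hκ hγ I y hy
  exact nonempty_memberHullInputs Z hκ hγ

/-- **The two held Literature constants of crux M's gen-1 / gen-2 splits are EQUIVALENT**: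
`exists_memberHullInputs ↔ exists_memberHullZetaInputs` (→ is the typer's forgetful theorem).
[cite: Kato2004Asterisque, Thm. 12.5 (1)–(3) (pp. 221–222), Thm. 14.5 (1)(2) (p. 236), §14.14 (p. 243)] -/
theorem exists_memberHullInputs_iff_zetaInputs :
    Kato2004.exists_memberHullInputs ↔ Kato2004.exists_memberHullZetaInputs :=
  ⟨Kato2004.exists_memberHullZetaInputs_of_memberHullInputs, exists_memberHullInputs_of_zetaInputs'⟩

/-! ## §4 The node: crux M from modularity and the zeta package ONLY -/

/-- **The node T-X3K = crux M from TWO named facts**: `exists_isNewformOf → exists_memberHullZetaInputs →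
O6.KatoMemberShaBoundOfReducible` — NO Gross–Zagier–Kolyvagin (cf. rkm g10's
`ReducibleOfZetaInputs.katoMemberShaBoundOfReducible_of_memberHullZetaInputs`, which took it as a third
hypothesis).  `nonempty_iwasawaH1Data` is discharged by `Kato2004.nonempty_iwasawaH1Data_holds` (rkm g4) and
the descent is the route-free node `ReducibleKatoMemberOfInputs.katoMemberShaBoundOfReducible_of_memberHullInputs`.
Conditional on the two named facts; nothing else assumed; no item is closed by this theorem.
[cite: Kato2004Asterisque, Thm. 12.6 (p. 222), Lemma 13.10 (1) (p. 230), 13.14 (p. 234), Thm. 14.5 (p. 236), §14.14 and Lemma 14.15 (pp. 243–244), Prop. 14.16 (2) (p. 244)]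
[cite: Wuthrich2014, Lemma 14 (p. 396)] -/
theorem katoMemberShaBoundOfReducible_of_newform_of_zetaInputs (hmod : exists_isNewformOf)
    (hZ : Kato2004.exists_memberHullZetaInputs) :
    Summit.BirchSwinnertonDyer.Rank1Residual.O6.KatoMemberShaBoundOfReducible :=
  ReducibleKatoMemberOfInputs.katoMemberShaBoundOfReducible_of_memberHullInputs
    Kato2004.nonempty_iwasawaH1Data_holds hmod (exists_memberHullInputs_of_zetaInputs' hZ)

end Summit.BirchSwinnertonDyer.BirchSwinnertonDyer.Theorems.ZetaInputsDescent

end
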